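import Literature.AnabelianGeometry.AbsoluteAnabelian.AbsTopIThm26SplitModelInstances
import Summits.ABC.IUTFork.MLFGaloisTFG
import HarnessLib

/-!
# [AbsTopI] Thm 2.6 (ii) AS TYPED at the split model `Π := Δ̂ × G_k ↠ G_k` — UNCONDITIONAL
# (abc-iut FACT-LIST row F-0247 `FundamentalExtension.Thm26ii`; `thm26ii_holds`)

Cell `abc-iut` (run/shared/lean/pub/abc-iut/), block F (fact-proving), tranche 90.  S. Mochizuki,
*Topics in Absolute Anabelian Geometry I* (2012) [AbsTopI], Thm 2.6 (ii) p. 21 (kurims manuscript,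
lit key `paper:url-11ac98ba15fc`).

The Literature file `AbsTopIThm26SplitModelInstances.lean` (abc-iut-f-090 gen 2) proves the typed
Thm 2.6 (ii) (`FundamentalExtension.Thm26ii B Σ`) at the SPLIT model `Π := Δ̂ × G_K ↠ G_K` with
`Δ̂` a pro-`Σ` completion of the free group `F_n` (`thm26ii_split_of_isProSigmaCompletion_freeGroup`;
`Δ̂ = F̂_n`, `Σ = Primes`: `thm26ii_split_profiniteCompletion_freeGroup`) GIVEN the one input of the
printed proof (p. 23 l. 11–13) that is a theorem of the tree only Summits-side: "the topological
finite generation … of `G` [cf. [NSW], Theorem 7.5.10]" (`isTopologicallyFinitelyGenerated_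
absoluteGaloisGroup_padic`, `Summits/ABC/IUTFork/MLFGaloisTFG.lean`, over the tree's
`localEulerPoincareCharacteristic_holds`).  A Literature file may not import a Summits file, so the
UNCONDITIONAL instances are assembled here (same pattern as abc-iut-f-090 gen 0's
`AbsTopIThm26iiPointInstance.lean` for the point extension `Δ = 1`):

* `FundamentalExtension.thm26ii_split_of_isProSigmaCompletion_freeGroup'` — every `Σ`, every pro-`Σ`
  completion `Δ̂` of `F_n`, every finite `K/ℚ_p`: NO hypotheses left;
* `FundamentalExtension.thm26ii_holds` — the closed instance `Δ̂ = F̂_n` (Mathlib's profinite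
  completion; `F̂₂` = [EtTh]'s model of `Δ_X`), `K = ℚ_p`, `Σ = Primes` (the case of [IUTchI–III]),
  base datum `(p, ℚ_p, refl)` — the `_holds` name the cell's FACT-LIST render keys on;
* `Summit.ABC.IUTFork.exists_thm26ii_geom_ne_bot` — hence an extension with MLF base data, `Δ ≠ 1`
  (indeed `δ¹_l(Π) − δ¹_l(G) = n ≥ 1`), satisfying the typed (ii): the row is satisfiable with a
  NON-DEGENERATE `Δ` (the sibling point instance had `Δ = 1`).

HONEST FRAMING: the split model has trivial outer action — it is NOT the extension of a hyperbolic
curve; a satisfiability witness of the typed predicate (whose universal closure is refuted,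
`not_forall_thm26ii`), with the printed "`dim Q`" realised as `n`.  Nothing here asserts anything
about abc or takes a side on [IUTchIII] Cor. 3.12; typed ≠ proved elsewhere.  Theorems only; axioms
standard.
-/

noncomputable section

namespace Summit.ABC.IUTFork

open Field Literature.AnabelianGeometry.AbsoluteAnabelian Literature.IUT.HodgeTheaters
open Literature.AnabelianGeometry.SemiGraphs.SemiGraphOfAnabelioids

/-- **[AbsTopI] Thm 2.6 (ii) AS TYPED at the split model, UNCONDITIONAL**: for every pro-`Σ`
completion `ι : F_n → Δ̂` (any `Σ`, any `n`) and every finite `K/ℚ_p`, the extension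
`Π := Δ̂ × G_K ↠ G_K` with base datum `(p, K, refl)` satisfies the typed (ii) for `Σ` — the
Literature theorem with its input "`G_K` topologically finitely generated" ([NSW] 7.5.10) DISCHARGED
by `isTopologicallyFinitelyGenerated_absoluteGaloisGroup_padic`. [cite: MochizukiAbsTopI2012, Thm 2.6 (ii) p.21]
[cite: NeukirchSchmidtWingberg2008, Thm. 7.5.10] -/
theorem _root_.Literature.AnabelianGeometry.AbsoluteAnabelian.FundamentalExtension.thm26ii_split_of_isProSigmaCompletion_freeGroup'
    (P : ProfiniteGrp.{0}) {n : ℕ} {S : Set ℕ} {ι : FreeGroup (Fin n) →* P}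
    (hι : IsProSigmaCompletion S ι) (p : ℕ) [Fact p.Prime] (K : Type) [Field K] [CharZero K]
    [Algebra ℚ_[p] K] [FiniteDimensional ℚ_[p] K] :
    Literature.AnabelianGeometry.AbsoluteAnabelian.FundamentalExtension.Thm26ii
      ⟨ProfiniteGrp.of (P × absoluteGaloisGroup K), absoluteGaloisGrp K,
        ContinuousMonoidHom.snd P (absoluteGaloisGroup K), Prod.snd_surjective⟩
      { p := p, K := K, galIso := ContinuousMulEquiv.refl _ } S :=
  FundamentalExtension.thm26ii_split_of_isProSigmaCompletion_freeGroup P K hι p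
    (isTopologicallyFinitelyGenerated_absoluteGaloisGroup_padic p K)

/-- **F-0247 `Thm26ii` — instance form PROVED, unconditionally, with a non-degenerate `Δ`
(`thm26ii_holds`).**  The split extension `Π := F̂_n × G_{ℚ_p} ↠ G_{ℚ_p}` (`F̂_n` = the profinite
completion of the free group `F_n`, a pro-`Σ` completion for `Σ = Primes`; `F̂₂` is [EtTh]'s model
of `Δ_X`) with MLF base datum `(p, ℚ_p, refl)` satisfies the typed [AbsTopI] Thm 2.6 (ii) for
`Σ = Primes`: "`Π` topologically finitely generated" (`F̂_n` by its `n` generators, `G_{ℚ_p}` by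
[NSW] 7.5.10 — `isTopologicallyFinitelyGenerated_absoluteGaloisGroup_padic`); "`δ¹_l(G) = 1`
(`l ≠ p`), `δ¹_p(G) = [k : ℚ_p] + 1`", "`ε¹_p(Π) = ∞`" (local class field theory, tree theorems);
"`δ¹_l(Π) − δ¹_l(G) = 0` for `l ∉ Σ`" (vacuous); "independent of `l ∈ Σ`": `= n`
(`freeProlRank_prod_eq_add_of_isProSigmaCompletion_freeGroup`).  HONEST LABEL: split model, trivial
outer action, not a curve's extension. [cite: MochizukiAbsTopI2012, Thm 2.6 (ii) p.21] -/
theorem _root_.Literature.AnabelianGeometry.AbsoluteAnabelian.FundamentalExtension.thm26ii_holds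
    (n p : ℕ) [Fact p.Prime] :
    Literature.AnabelianGeometry.AbsoluteAnabelian.FundamentalExtension.Thm26ii
      ⟨ProfiniteGrp.of (profiniteCompletion (FreeGroup (Fin n)) × absoluteGaloisGroup ℚ_[p]),
        absoluteGaloisGrp ℚ_[p],
        ContinuousMonoidHom.snd (profiniteCompletion (FreeGroup (Fin n))) (absoluteGaloisGroup ℚ_[p]),
        Prod.snd_surjective⟩
      { p := p, K := ℚ_[p], galIso := ContinuousMulEquiv.refl _ } {q | q.Prime} :=
  FundamentalExtension.thm26ii_split_profiniteCompletion_freeGroup ℚ_[p] n p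
    (isTopologicallyFinitelyGenerated_absoluteGaloisGroup_padic p ℚ_[p])

/-- **An extension with MLF base data, NON-TRIVIAL `Δ`, satisfying the typed [AbsTopI] Thm 2.6 (ii)
for `Σ = Primes`** — the split model `F̂_n × G_{ℚ_p} ↠ G_{ℚ_p}` with `n ≥ 1`: `Δ = F̂_n × 1 ≠ 1`
because `δ¹_p(Π) = δ¹_p(G) + n > δ¹_p(G)` (an extension with `Δ = 1` has `Π ≅ G`).  Complements the
sibling point instance (`exists_geom_eq_bot_thm26ii`, `Δ = 1`). [cite: MochizukiAbsTopI2012, Thm 2.6 (ii) p.21] -/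
theorem exists_thm26ii_geom_ne_bot (n p : ℕ) [Fact p.Prime] (hn : 1 ≤ n) :
    ∃ (E : FundamentalExtension.{0}) (B : E.MLFBase), E.geom ≠ ⊥ ∧ E.Thm26ii B {q | q.Prime} := by
  let P : ProfiniteGrp.{0} := profiniteCompletion (FreeGroup (Fin n))
  let Γ := absoluteGaloisGroup ℚ_[p]
  let E : FundamentalExtension.{0} :=
    ⟨ProfiniteGrp.of (P × Γ), absoluteGaloisGrp ℚ_[p], ContinuousMonoidHom.snd P Γ,
      Prod.snd_surjective⟩
  let B : E.MLFBase := { p := p, K := ℚ_[p], galIso := ContinuousMulEquiv.refl _ }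
  refine ⟨E, B, fun hΔ => ?_, FundamentalExtension.thm26ii_holds n p⟩
  -- if `Δ = 1` then `aug : Π → G` is a continuous bijection, so `δ¹_p(Π) ≤ δ¹_p(G)`
  have hinj : Function.Injective E.aug := (MonoidHom.ker_eq_bot_iff E.aug.toMonoidHom).mp hΔ
  let e₀ : E.arith ≃ E.gal := Equiv.ofBijective E.aug ⟨hinj, E.aug_surjective⟩
  let eₜ : E.arith ≃ₜ E.gal := Continuous.homeoOfEquivCompactToT2 (f := e₀) (map_continuous E.aug)
  let e : E.arith ≃ₜ* E.gal := ContinuousMulEquiv.mk' eₜ fun x y => map_mul E.aug x y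
  have hrank : freeProlRank E.arith p = freeProlRank E.gal p :=
    freeProlRank_eq_of_continuousMulEquiv e p
  -- but `δ¹_p(Π) = δ¹_p(G) + n` with `n ≥ 1` and `δ¹_p(G) = [ℚ_p : ℚ_p] + 1` finite
  have hadd : freeProlRank E.arith p = freeProlRank E.gal p + n :=
    freeProlRank_prod_eq_add_of_isProSigmaCompletion_freeGroup
      (IsProSigmaCompletion.isProSigmaCompletion_toCompletion (FreeGroup (Fin n))) p
      (Fact.out : p.Prime)
  have hG : freeProlRank E.gal p = (Module.finrank ℚ_[p] ℚ_[p] + 1 : ℕ) :=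
    (FundamentalExtension.freeProlRank_gal B).2
  rw [hrank, hG] at hadd
  have h : (Module.finrank ℚ_[p] ℚ_[p] + 1 : ℕ) = Module.finrank ℚ_[p] ℚ_[p] + 1 + n := by
    exact_mod_cast hadd
  omega

end Summit.ABC.IUTFork

end
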